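/-
Copyright (c) 2026 the pub-hodgecm-mathlib formalisation cell (harness21).  Prover seat hodgecm-mathlib-K2E3-p21 (g3), HCML Track B «K2-LIT» (build stream 29),
h413 = `stmt-HodgeConjecture-24833`, line `K2_E3_EllipticInputs`, unit U12 «Characters», socket #11 road (11-SC), letter (SC-an): HARISH-CHANDRA'S THEOREM 20
«cusp-form cancellation», DISCHARGE of the abstract hypotheses of ★ (T20-e2) `K2E3CuspFormCancellationHeights` at the model `U(σ, Φ₃)(K)`, FILE 2 «THE INPUTS»: torus
normalisation, Lemma 54, the four conjugation bounds (`A^±` on `N`, `N̄`), `K_γ ⊆ Ω_0`, the conjugate level — line lead K2E3-p20 (g3); split with K2E3-p14 (g3) (T20-e1).  2026-09-04.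
-/
import Summits.HodgeConjecture.HodgeConjecture.Theorems.K2E3CuspFormCancellationU3Torus   -- ★ (this seat) FILE 1: `diag_mem_heightBall_iff`, `v_inv_le_pow_succ_of_not_mem`, `v_le_pow_succ_of_not_mem`, `v_ratio_le_*`, `valuation_mul_le_pow_of_le`, `valuation_mul_le_of_v_le_one`, entries; brings ★ (T20-c)
import Literature.NumberTheory.Automorphic.JacquetNonzeroEmbedsNormalizedInd                   -- ★ `torusU_mul_comm` (the diagonal torus of `U(σ, Φ_N)` is commutative)
import HarnessLib

/-!
# h413 ∕ Track B «K2-LIT», (SC-an) Theorem-20 line — DISCHARGE FILE 2: THE HYPOTHESES OF ★ (T20-e2) `cuspForm_trichotomy_*` AT `U(σ, Φ₃)(K)`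
# (`hT`, `hnormN`, `hnormNbar`, `h54N`, `h54Nbar`, `hplusV`, `hminusV`, `hplusC`, `hminusC`, `hAcover`, `K_γ ⊆ Ω_0`, the conjugate level `K₀(y⁻¹)`)
# (Harish-Chandra 1970, Part VII §8 Lemmas 54–56 pp. 81–83; Casselman 1995, Prop. 1.4.3)

Cell `pub/hodgecm-mathlib`, crux H413 = `stmt-HodgeConjecture-24833`, route of record `HCCMUnconditional`; chair K2-lead (g0), dealer K2E3-plan (g2), line lead K2E3-p20 (g3).
THEOREMS ONLY (no `def`, no `instance`, no `notation`, no named-fact hypothesis, no `sorry`); lane `--supports stmt-HodgeConjecture-24833 --as helper`, count-neutral.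

SETTING (model currency of ★ p856390 §1 ∕ ★ (T20-c) ∕ ★ (T20-d)): `K` a field with compatible `Valued K ℤᵐ⁰` and `ValuativeRel`, `σ : K →+* K` isometric, `J = Φ₃`,
`U = ↥(unitaryGroupOfForm σ J)`; a uniformiser `ϖ`; an abstract `Ω : ℕ → Set U` with the MEMBERSHIP of ★ `exists_heightBall_compactExhaustion` (`hmem`), its inversion
symmetry (`hinv`) and submultiplicativity (`hmul`) as hypotheses (so (T20-f) feeds the `Ω` it obtains); `T = torusU`, `N = (borelTriple σ J hJ).N`, `N̄ = N.map (conj w₀)`;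
levels `K_γ := (congruenceGL 3 γ).comap U.subtype`; `A⁺ := {a : ∃ d, diag d = a ∧ 1 ≤ |d₀|}`, `A⁻ := {… |d₀| ≤ 1}` (spelled as set-builder terms; no definition is introduced).
* §1 conjugate entries `coe_conj_diag_apply` ∕ `coe_inv_conj_diag_apply`; unit diagonals and zero patterns of `N`, `N̄` (`apply_self_eq_one_of_mem_N`, `apply_eq_zero_of_mem_N`, `…_Nbar`).
* §2 `conj_mem_level_of_mem_torusU` (`hT`: `T` is commutative ★ `torusU_mul_comm`), `conj_mem_N_of_mem_torusU` (`hnormN`), `conj_mem_Nbar_of_mem_torusU` (`hnormNbar`),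
  `torusU_mem_plus_or_minus` (`hAcover`).
* §3 LEMMA 54 `mem_heightBall_two_mul_of_mul_mem_N` ∕ `_Nbar` (`n·a ∈ Ω_c ⇒ n ∈ Ω_{2c}`: the diagonal of `n a` is that of `a`, ★ FILE 1 `diag_mem_heightBall_iff`).
* §4 THE FOUR CONJUGATION BOUNDS: generic `valBound_diag_conj_sub_one` (non-expanding root values keep the level) and `valBound_diag_conj_sub_one_le_pow` (contracting root values
  `≤ |ϖ^{h+1}|` send `Ω_c ∩ X` into level `|ϖ|^j`, `j + c ≤ h + 1`); then **`conj_mem_level_of_plus_of_mem_Nbar`** (`hplusV`), **`conj_mem_level_of_minus_of_mem_N`** (`hminusV`),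
  **`inv_conj_mem_level_of_plus_of_mem_N`** (`hplusC`), **`inv_conj_mem_level_of_minus_of_mem_Nbar`** (`hminusC`).
* §5 `coe_level_subset_heightBall_zero` (`K_γ ⊆ Ω_0`, ★ (T20-c) §4) and `mem_inf_map_conj_iff` (`k ∈ K₀ ⊓ K₀.map (conj y⁻¹) ↔ k ∈ K₀ ∧ y k y⁻¹ ∈ K₀`).
With ★ (T20-c) (`exists_iwahori_factorisations_of_mem_comap_congruenceGL`, `conj_mem_comap_congruenceGL_of_heightBall`) these are ALL the inputs of ★ (T20-e2)
`cuspForm_trichotomy_conjLevel` at `U(σ,Φ₃)(K)` except the support datum `supp f ⊆ C·T` of the cusp form ((T20-b), K2E3-p20) — assembled in FILE 3.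

HONEST LABEL.  HC_CM is proved only modulo the 7 printed citations (2 remaining named inputs: hLiu418 = `stmt-HodgeConjecture-24832`, h413 = `stmt-HodgeConjecture-24833`)
until rung 0 closes; count-neutral helper.

## References
* [HarishChandra1970] Harish-Chandra (notes by G. van Dijk), *Harmonic Analysis on Reductive p-adic Groups*, LNM 162 (1970), Part VII §8 pp. 81–83 (Lemmas 54–56;
  `(N̄ ∩ K)^a(M ∩ K) ⊂ ω₀`; `(a⁻¹n′a)_{ij} = a_i⁻¹a_j n′_{ij}`).
* [Casselman1995] W. Casselman, *Introduction to the theory of admissible representations of `p`-adic reductive groups* (1995 notes), Prop. 1.4.3.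
* [Rogawski1990] J. D. Rogawski, *Automorphic Representations of Unitary Groups in Three Variables*, Ann. of Math. Stud. 123 (1990), §1.10 p. 9 (`B = MN`, `M`, `w₀`).
-/

set_option autoImplicit false
set_option linter.dupNamespace false  -- the mandated namespace repeats the single-problem summit's segment (`HodgeConjecture.HodgeConjecture`)

noncomputable section

open scoped MatrixGroups WithZero Pointwise
open ValuativeRel Matrix
open Literature.NumberTheory.Automorphic Literature.NumberTheory.Automorphic.UnitaryGroup
open Summit.HodgeConjecture.HodgeConjecture.Cruxes.H413.K2E3CuspFormCancellationU3Torus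

namespace Summit.HodgeConjecture.HodgeConjecture.Cruxes.H413.K2E3CuspFormCancellationU3Inputs

section Model

variable {K : Type*} [Field K] [Valued K ℤᵐ⁰] [ValuativeRel K] [(Valued.v : Valuation K ℤᵐ⁰).Compatible]
  (σ : K →+* K) (hσv : ∀ x, Valued.v (σ x) = Valued.v x) {J : Matrix (Fin 3) (Fin 3) K} (hJ : J = (StdForm.antidiagonal 3).over K)
  {ϖ : K} (hϖ : Valued.v ϖ = WithZero.exp (-1 : ℤ))
  (Ω : ℕ → Set ↥(unitaryGroupOfForm σ J))
  (hmem : ∀ (m : ℕ) (g : ↥(unitaryGroupOfForm σ J)), g ∈ Ω m ↔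
    (∀ i j, Valued.v (ϖ ^ m * ((g : GL (Fin 3) K) : Matrix (Fin 3) (Fin 3) K) i j) ≤ 1) ∧
      ∀ i j, Valued.v (ϖ ^ m * (((g : GL (Fin 3) K)⁻¹ : GL (Fin 3) K) : Matrix (Fin 3) (Fin 3) K) i j) ≤ 1)
  (hinv : ∀ (m : ℕ) (g : ↥(unitaryGroupOfForm σ J)), g ∈ Ω m → g⁻¹ ∈ Ω m)
  (hmul : ∀ (a b : ℕ) (g h : ↥(unitaryGroupOfForm σ J)), g ∈ Ω a → h ∈ Ω b → g * h ∈ Ω (a + b))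

/-! ## §1 Entries of conjugates by a torus element; unit diagonals and zero patterns of `N` and `N̄` -/

omit [Valued K ℤᵐ⁰] [ValuativeRel K] [(Valued.v : Valuation K ℤᵐ⁰).Compatible] in
/-- `(a x a⁻¹)_{ij} = d_i x_{ij} d_j⁻¹` for `a = diag(d)`. [cite: HarishChandra1970, Part VII §8 p. 82] -/
theorem coe_conj_diag_apply {a : ↥(unitaryGroupOfForm σ J)} {d : Fin 3 → Kˣ} (hd : glDiagonal 3 K d = (a : GL (Fin 3) K))
    (x : ↥(unitaryGroupOfForm σ J)) (i j : Fin 3) :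
    (((a * x * a⁻¹ : ↥(unitaryGroupOfForm σ J)) : GL (Fin 3) K) : Matrix (Fin 3) (Fin 3) K) i j =
      (d i : K) * ((x : GL (Fin 3) K) : Matrix (Fin 3) (Fin 3) K) i j * ((d j : K))⁻¹ := by
  rw [Subgroup.coe_mul, Subgroup.coe_mul, Subgroup.coe_inv, Units.val_mul, Units.val_mul, ← hd, coe_inv_glDiagonal, coe_glDiagonal,
    K2E3CuspFormCancellationU3Torus.diagonal_mul_mul_diagonal_apply]

omit [Valued K ℤᵐ⁰] [ValuativeRel K] [(Valued.v : Valuation K ℤᵐ⁰).Compatible] in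
/-- `(a⁻¹ x a)_{ij} = d_i⁻¹ x_{ij} d_j` for `a = diag(d)`. [cite: HarishChandra1970, Part VII §8 p. 82] -/
theorem coe_inv_conj_diag_apply {a : ↥(unitaryGroupOfForm σ J)} {d : Fin 3 → Kˣ} (hd : glDiagonal 3 K d = (a : GL (Fin 3) K))
    (x : ↥(unitaryGroupOfForm σ J)) (i j : Fin 3) :
    (((a⁻¹ * x * a : ↥(unitaryGroupOfForm σ J)) : GL (Fin 3) K) : Matrix (Fin 3) (Fin 3) K) i j =
      ((d i : K))⁻¹ * ((x : GL (Fin 3) K) : Matrix (Fin 3) (Fin 3) K) i j * (d j : K) := by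
  rw [Subgroup.coe_mul, Subgroup.coe_mul, Subgroup.coe_inv, Units.val_mul, Units.val_mul, ← hd, coe_inv_glDiagonal, coe_glDiagonal,
    K2E3CuspFormCancellationU3Torus.diagonal_mul_mul_diagonal_apply]

omit [Valued K ℤᵐ⁰] [ValuativeRel K] [(Valued.v : Valuation K ℤᵐ⁰).Compatible] in
/-- An element of `N = unipotentU` has unit diagonal and zeros below it. [cite: Rogawski1990, §1.10 p. 9] -/
theorem apply_of_mem_N {n : ↥(unitaryGroupOfForm σ J)} (hn : n ∈ (borelTriple σ J hJ).N) :
    (∀ i, ((n : GL (Fin 3) K) : Matrix (Fin 3) (Fin 3) K) i i = 1) ∧ ∀ i j : Fin 3, j < i → ((n : GL (Fin 3) K) : Matrix (Fin 3) (Fin 3) K) i j = 0 := by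
  have hn' : n ∈ unipotentU σ J := hn
  rw [mem_unipotentU_iff] at hn'
  exact ⟨hn'.2, fun i j hji => hn'.1 hji⟩

omit [Valued K ℤᵐ⁰] [ValuativeRel K] [(Valued.v : Valuation K ℤᵐ⁰).Compatible] in
/-- An element of `N̄ = w₀ N w₀` has unit diagonal and zeros ABOVE it (`(w₀ u w₀)_{ij} = u_{2−i, 2−j}`, `w₀⁻¹ = w₀`). [cite: Rogawski1990, §1.10 p. 9] -/
theorem apply_of_mem_Nbar {v : ↥(unitaryGroupOfForm σ J)} (hv : v ∈ ((borelTriple σ J hJ).N).map (MulAut.conj (weylLongU σ hJ)).toMonoidHom) :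
    (∀ i, ((v : GL (Fin 3) K) : Matrix (Fin 3) (Fin 3) K) i i = 1) ∧ ∀ i j : Fin 3, i < j → ((v : GL (Fin 3) K) : Matrix (Fin 3) (Fin 3) K) i j = 0 := by
  have hw1 : weylLongU σ hJ * weylLongU σ hJ = 1 := weylLongU_mul_weylLongU σ hJ
  have hwinv : (weylLongU σ hJ)⁻¹ = weylLongU σ hJ := (eq_inv_of_mul_eq_one_left hw1).symm
  rw [Subgroup.mem_map_equiv, MulAut.conj_symm_apply, hwinv] at hv
  obtain ⟨h1, h0⟩ := apply_of_mem_N σ hJ hv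
  have hv_eq : v = weylLongU σ hJ * (weylLongU σ hJ * v * weylLongU σ hJ) * weylLongU σ hJ := by
    rw [← mul_assoc, ← mul_assoc, hw1, one_mul, mul_assoc, hw1, mul_one]
  refine ⟨fun i => ?_, fun i j hij => ?_⟩
  · conv_lhs => rw [hv_eq]
    rw [coe_weylLongU_mul_mul_weylLongU_apply]; exact h1 _
  · conv_lhs => rw [hv_eq]
    rw [coe_weylLongU_mul_mul_weylLongU_apply]
    exact h0 _ _ (Fin.rev_lt_rev.2 hij)

/-! ## §2 Torus: commutativity (`hT`), normalisation of `N`, `N̄`, and the `A⁺ ∪ A⁻` cover -/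

omit [Valued K ℤᵐ⁰] [ValuativeRel K] [(Valued.v : Valuation K ℤᵐ⁰).Compatible] in
/-- **`hT`**: `a t a⁻¹ = t` for `a, t ∈ T` (the diagonal torus is commutative, ★ `torusU_mul_comm`), so `a (K_γ ⊓ T) a⁻¹ ⊆ K_γ`. [cite: Rogawski1990, §1.10 p. 9] -/
theorem conj_mem_level_of_mem_torusU (L₀ : Subgroup ↥(unitaryGroupOfForm σ J)) {a : ↥(unitaryGroupOfForm σ J)} (ha : a ∈ (borelTriple σ J hJ).M)
    {t : ↥(unitaryGroupOfForm σ J)} (ht : t ∈ L₀ ⊓ (borelTriple σ J hJ).M) : a * t * a⁻¹ ∈ L₀ := by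
  have hcomm := torusU_mul_comm (σ := σ) (J := J) ⟨a, ha⟩ ⟨t, (Subgroup.mem_inf.1 ht).2⟩
  have h' : a * t = t * a := congrArg Subtype.val hcomm
  rw [h', mul_inv_cancel_right]
  exact (Subgroup.mem_inf.1 ht).1

omit [Valued K ℤᵐ⁰] [ValuativeRel K] [(Valued.v : Valuation K ℤᵐ⁰).Compatible] in
/-- **`hnormN`**: `T` normalises `N` (`(a n a⁻¹)_{ij} = d_i n_{ij} d_j⁻¹` keeps the unit diagonal and the zeros below). [cite: Rogawski1990, §1.10 p. 9] -/
theorem conj_mem_N_of_mem_torusU {a : ↥(unitaryGroupOfForm σ J)} (ha : a ∈ (borelTriple σ J hJ).M)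
    {n : ↥(unitaryGroupOfForm σ J)} (hn : n ∈ (borelTriple σ J hJ).N) : a * n * a⁻¹ ∈ (borelTriple σ J hJ).N := by
  obtain ⟨d, hd⟩ := (mem_torusU_iff a).1 ha
  obtain ⟨h1, h0⟩ := apply_of_mem_N σ hJ hn
  show a * n * a⁻¹ ∈ unipotentU σ J
  rw [mem_unipotentU_iff]
  refine ⟨fun i j hji => ?_, fun i => ?_⟩
  · rw [coe_conj_diag_apply σ hd, h0 i j hji, mul_zero, zero_mul]
  · rw [coe_conj_diag_apply σ hd, h1 i, mul_one, mul_inv_cancel₀ (d i).ne_zero]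

omit [Valued K ℤᵐ⁰] [ValuativeRel K] [(Valued.v : Valuation K ℤᵐ⁰).Compatible] in
/-- **`hnormNbar`**: `T` normalises `N̄ = w₀ N w₀` (`w₀ a w₀ ∈ T` and `w₀⁻¹ = w₀`). [cite: Rogawski1990, §1.10 p. 9] -/
theorem conj_mem_Nbar_of_mem_torusU {a : ↥(unitaryGroupOfForm σ J)} (ha : a ∈ (borelTriple σ J hJ).M)
    {v : ↥(unitaryGroupOfForm σ J)} (hv : v ∈ ((borelTriple σ J hJ).N).map (MulAut.conj (weylLongU σ hJ)).toMonoidHom) :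
    a * v * a⁻¹ ∈ ((borelTriple σ J hJ).N).map (MulAut.conj (weylLongU σ hJ)).toMonoidHom := by
  have hw1 : weylLongU σ hJ * weylLongU σ hJ = 1 := weylLongU_mul_weylLongU σ hJ
  have hwinv : (weylLongU σ hJ)⁻¹ = weylLongU σ hJ := (eq_inv_of_mul_eq_one_left hw1).symm
  obtain ⟨d, hd⟩ := (mem_torusU_iff a).1 ha
  rw [Subgroup.mem_map_equiv, MulAut.conj_symm_apply, hwinv] at hv ⊢
  have haw : weylLongU σ hJ * a * weylLongU σ hJ ∈ (borelTriple σ J hJ).M :=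
    (mem_torusU_iff _).2 ⟨d ∘ Fin.rev, (coe_weylLongU_mul_mul_weylLongU_of_eq_glDiagonal σ hJ hd.symm).symm⟩
  have key : weylLongU σ hJ * (a * v * a⁻¹) * weylLongU σ hJ =
      (weylLongU σ hJ * a * weylLongU σ hJ) * (weylLongU σ hJ * v * weylLongU σ hJ) * (weylLongU σ hJ * a * weylLongU σ hJ)⁻¹ := by
    rw [_root_.mul_inv_rev, _root_.mul_inv_rev, hwinv]
    calc weylLongU σ hJ * (a * v * a⁻¹) * weylLongU σ hJ
        = weylLongU σ hJ * a * 1 * v * 1 * a⁻¹ * weylLongU σ hJ := by group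
      _ = weylLongU σ hJ * a * (weylLongU σ hJ * weylLongU σ hJ) * v * (weylLongU σ hJ * weylLongU σ hJ) * a⁻¹ * weylLongU σ hJ := by rw [hw1]
      _ = weylLongU σ hJ * a * weylLongU σ hJ * (weylLongU σ hJ * v * weylLongU σ hJ) * (weylLongU σ hJ * (a⁻¹ * weylLongU σ hJ)) := by group
  rw [key]
  exact conj_mem_N_of_mem_torusU σ hJ haw hv

omit [ValuativeRel K] [(Valued.v : Valuation K ℤᵐ⁰).Compatible] in
/-- **`hAcover`**: every `a ∈ T` lies in `A⁺ = {|d₀| ≥ 1}` or in `A⁻ = {|d₀| ≤ 1}`. [cite: HarishChandra1970, Part VII §8 p. 81] -/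
theorem torusU_mem_plus_or_minus :
    ∀ a ∈ (borelTriple σ J hJ).M,
      a ∈ {a : ↥(unitaryGroupOfForm σ J) | ∃ d : Fin 3 → Kˣ, glDiagonal 3 K d = (a : GL (Fin 3) K) ∧ 1 ≤ Valued.v (d 0 : K)} ∨
      a ∈ {a : ↥(unitaryGroupOfForm σ J) | ∃ d : Fin 3 → Kˣ, glDiagonal 3 K d = (a : GL (Fin 3) K) ∧ Valued.v (d 0 : K) ≤ 1} := by
  intro a ha
  obtain ⟨d, hd⟩ := (mem_torusU_iff a).1 ha
  rcases le_total 1 (Valued.v (d 0 : K)) with h | h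
  · exact Or.inl ⟨d, hd, h⟩
  · exact Or.inr ⟨d, hd, h⟩

/-! ## §3 Lemma 54: `n·a ∈ Ω_c ⇒ n ∈ Ω_{2c}` (the diagonal of `n a` is that of `a`) -/

omit [ValuativeRel K] [(Valued.v : Valuation K ℤᵐ⁰).Compatible] in
include hσv hJ hϖ hmem hinv hmul in
/-- LEMMA 54's input for a unit-diagonal `x` (`x_{ii} = (x⁻¹)_{ii} = 1`): if `x·a ∈ Ω_c` with `a = diag(d) ∈ T` then `a ∈ Ω_c` (the diagonal of `x a` is `d`, that of
`(x a)⁻¹ = a⁻¹x⁻¹` is `d⁻¹`; ★ FILE 1 `diag_mem_heightBall_iff`), hence `x = (x a)·a⁻¹ ∈ Ω_{2c}` («`‖a‖ ≤ ‖n′a‖`, `‖n′‖ ≤ ‖n′a‖‖a⁻¹‖ ≤ ‖n′a‖²`).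
[cite: HarishChandra1970, Part VII §8 Lemma 54 p. 82] -/
theorem mem_heightBall_two_mul_of_mul_mem {x a : ↥(unitaryGroupOfForm σ J)}
    (hx1 : ∀ i, ((x : GL (Fin 3) K) : Matrix (Fin 3) (Fin 3) K) i i = 1) (hx1' : ∀ i, (((x : GL (Fin 3) K)⁻¹ : GL (Fin 3) K) : Matrix (Fin 3) (Fin 3) K) i i = 1)
    (ha : a ∈ (borelTriple σ J hJ).M) {c : ℕ} (hxa : x * a ∈ Ω c) : x ∈ Ω (2 * c) := by
  obtain ⟨d, hd⟩ := (mem_torusU_iff a).1 ha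
  obtain ⟨hA, hB⟩ := (hmem c (x * a)).1 hxa
  have hmat : ((a : GL (Fin 3) K) : Matrix (Fin 3) (Fin 3) K) = diagonal fun i => (d i : K) := by rw [← hd, coe_glDiagonal]
  have hmatinv : (((a : GL (Fin 3) K)⁻¹ : GL (Fin 3) K) : Matrix (Fin 3) (Fin 3) K) = diagonal fun i => ((d i : K))⁻¹ := by rw [← hd, coe_inv_glDiagonal]
  -- the `(0,0)` entries of `x a` and `(x a)⁻¹ = a⁻¹ x⁻¹`
  have h0 : Valued.v (ϖ ^ c * (d 0 : K)) ≤ 1 := by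
    have := hA 0 0
    rwa [Subgroup.coe_mul, Units.val_mul, hmat, mul_diagonal, hx1, one_mul] at this
  have h0' : Valued.v (ϖ ^ c * (d 0 : K)⁻¹) ≤ 1 := by
    have := hB 0 0
    rwa [Subgroup.coe_mul, _root_.mul_inv_rev, Units.val_mul, hmatinv, diagonal_mul, hx1', mul_one] at this
  have haΩ : a ∈ Ω c := (diag_mem_heightBall_iff σ hσv hJ hϖ Ω hmem hd c).2 ⟨h0, h0'⟩
  have h2 := hmul c c (x * a) a⁻¹ hxa (hinv c a haΩ)
  rw [mul_inv_cancel_right, ← two_mul] at h2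
  exact h2

omit [ValuativeRel K] [(Valued.v : Valuation K ℤᵐ⁰).Compatible] in
include hσv hJ hϖ hmem hinv hmul in
/-- **`h54N`**: `n ∈ N`, `a ∈ T`, `n·a ∈ Ω_c ⇒ n ∈ Ω_{2c}`. [cite: HarishChandra1970, Part VII §8 Lemma 54 p. 82] -/
theorem mem_heightBall_two_mul_of_mul_mem_N : ∀ n ∈ (borelTriple σ J hJ).N, ∀ a ∈ (borelTriple σ J hJ).M, ∀ c : ℕ, n * a ∈ Ω c → n ∈ Ω (2 * c) := by
  intro n hn a ha c hna
  exact mem_heightBall_two_mul_of_mul_mem σ hσv hJ hϖ Ω hmem hinv hmul (apply_of_mem_N σ hJ hn).1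
    (by have := (apply_of_mem_N σ hJ ((borelTriple σ J hJ).N.inv_mem hn)).1; rwa [Subgroup.coe_inv] at this) ha hna

omit [ValuativeRel K] [(Valued.v : Valuation K ℤᵐ⁰).Compatible] in
include hσv hJ hϖ hmem hinv hmul in
/-- **`h54Nbar`**: `v ∈ N̄`, `a ∈ T`, `v·a ∈ Ω_c ⇒ v ∈ Ω_{2c}`. [cite: HarishChandra1970, Part VII §8 Lemma 54 p. 82] -/
theorem mem_heightBall_two_mul_of_mul_mem_Nbar :
    ∀ v ∈ ((borelTriple σ J hJ).N).map (MulAut.conj (weylLongU σ hJ)).toMonoidHom, ∀ a ∈ (borelTriple σ J hJ).M, ∀ c : ℕ, v * a ∈ Ω c → v ∈ Ω (2 * c) := by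
  intro v hv a ha c hva
  exact mem_heightBall_two_mul_of_mul_mem σ hσv hJ hϖ Ω hmem hinv hmul (apply_of_mem_Nbar σ hJ hv).1
    (by have := (apply_of_mem_Nbar σ hJ (Subgroup.inv_mem _ hv)).1; rwa [Subgroup.coe_inv] at this) ha hva

/-! ## §4 The four conjugation bounds -/

omit [Valued K ℤᵐ⁰] [(Valued.v : Valuation K ℤᵐ⁰).Compatible] in
/-- Membership in a level `K_γ ∩ U`, `γ ≤ 1`, from the two `ValBound`s of `g − 1` and `g⁻¹ − 1` (integrality is automatic). [cite: Casselman1995, Prop. 1.4.3] -/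
theorem mem_level_of_valBound {γ : ValueGroupWithZero K} (hγ : γ ≤ 1) {g : ↥(unitaryGroupOfForm σ J)}
    (h1 : ValBound γ (((g : GL (Fin 3) K) : Matrix (Fin 3) (Fin 3) K) - 1))
    (h2 : ValBound γ ((((g : GL (Fin 3) K)⁻¹ : GL (Fin 3) K) : Matrix (Fin 3) (Fin 3) K) - 1)) :
    g ∈ (congruenceGL 3 γ).comap (unitaryGroupOfForm σ J).subtype :=
  ⟨⟨h1.of_sub_one hγ, h2.of_sub_one hγ⟩, h1, h2⟩

/-- **NON-EXPANDING ROOT VALUES KEEP THE LEVEL** (generic): `X` with unit diagonal, `ValBound γ (X − 1)`, and `|d_i d_j⁻¹| ≤ 1` wherever `X_{ij} ≠ 0` off the diagonal ⇒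
`ValBound γ (diag(d)·X·diag(d)⁻¹ − 1)` (print: `(N̄ ∩ K)^a ⊂ ω₀ = K`). [cite: HarishChandra1970, Part VII §8 p. 81] [cite: Casselman1995, Prop. 1.4.3] -/
theorem valBound_diag_conj_sub_one {γ : ValueGroupWithZero K} {X : Matrix (Fin 3) (Fin 3) K} (d : Fin 3 → Kˣ) (hX1 : ∀ i, X i i = 1)
    (hX : ValBound γ (X - 1)) (hr : ∀ i j, i ≠ j → X i j ≠ 0 → Valued.v ((d i : K) * ((d j : K))⁻¹) ≤ 1) :
    ValBound γ ((diagonal (fun i => (d i : K)) * X * diagonal fun i => ((d i : K))⁻¹) - 1) := by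
  intro i j
  rw [Matrix.sub_apply, K2E3CuspFormCancellationU3Torus.diagonal_mul_mul_diagonal_apply]
  by_cases hij : i = j
  · subst hij
    rw [hX1, mul_one, mul_inv_cancel₀ (d i).ne_zero, Matrix.one_apply_eq, sub_self, map_zero]; exact zero_le
  · rw [Matrix.one_apply_ne hij, sub_zero]
    by_cases h0 : X i j = 0
    · rw [h0, mul_zero, zero_mul, map_zero]; exact zero_le
    · have hXij : valuation K (X i j) ≤ γ := by
        have := hX i j; rwa [Matrix.sub_apply, Matrix.one_apply_ne hij, sub_zero] at this
      have e : (d i : K) * X i j * ((d j : K))⁻¹ = X i j * ((d i : K) * ((d j : K))⁻¹) := by ring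
      rw [e]
      exact valuation_mul_le_of_v_le_one hXij (hr i j hij h0)

include hϖ in
/-- **CONTRACTING ROOT VALUES SEND `Ω_c` INTO A DEEP LEVEL** (generic): `X` with unit diagonal, `|ϖ^c X_{ij}| ≤ 1` for all entries, and `|d_i⁻¹ d_j| ≤ |ϖ^{h+1}|` wherever
`X_{ij} ≠ 0` off the diagonal; then for `j₀ + c ≤ h + 1`: `ValBound (valuation ϖ ^ j₀) (diag(d)⁻¹·X·diag(d) − 1)` (Lemma 55's `|a⁻¹n′a − 1| ≤ q^{σ(n′) − ν(a)δ}`).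
[cite: HarishChandra1970, Part VII §8 Lemma 55 p. 83] -/
theorem valBound_diag_inv_conj_sub_one_le_pow {X : Matrix (Fin 3) (Fin 3) K} (d : Fin 3 → Kˣ) (hX1 : ∀ i, X i i = 1) {c h j₀ : ℕ}
    (hXΩ : ∀ i j, Valued.v (ϖ ^ c * X i j) ≤ 1) (hr : ∀ i j, i ≠ j → X i j ≠ 0 → Valued.v (((d i : K))⁻¹ * (d j : K)) ≤ Valued.v (ϖ ^ (h + 1)))
    (hjc : j₀ + c ≤ h + 1) :
    ValBound (valuation K ϖ ^ j₀) ((diagonal (fun i => ((d i : K))⁻¹) * X * diagonal fun i => (d i : K)) - 1) := by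
  intro i j
  rw [Matrix.sub_apply, K2E3CuspFormCancellationU3Torus.diagonal_mul_mul_diagonal_apply]
  by_cases hij : i = j
  · subst hij
    rw [hX1, mul_one, inv_mul_cancel₀ (d i).ne_zero, Matrix.one_apply_eq, sub_self, map_zero]; exact zero_le
  · rw [Matrix.one_apply_ne hij, sub_zero]
    by_cases h0 : X i j = 0
    · rw [h0, mul_zero, zero_mul, map_zero]; exact zero_le
    · have e : ((d i : K))⁻¹ * X i j * (d j : K) = X i j * (((d i : K))⁻¹ * (d j : K)) := by ring
      rw [e]
      exact valuation_mul_le_pow_of_le hϖ (hXΩ i j) (hr i j hij h0) hjc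

include hϖ in
/-- `|ϖ|^j ≤ 1` in the `ValuativeRel` currency. [cite: Casselman1995, Prop. 1.4.3] -/
theorem valuation_pow_le_one (j : ℕ) : valuation K ϖ ^ j ≤ 1 := by
  refine pow_le_one' ?_ j
  rw [← v_le_one_iff_valuation_le_one, hϖ, ← WithZero.exp_zero, WithZero.exp_le_exp]; norm_num

include hσv hJ in
/-- **`hplusV`**: for `a ∈ A⁺` (`a = diag d`, `1 ≤ |d₀|`) and `v ∈ K_γ ⊓ N̄` (`γ ≤ 1`): `a v a⁻¹ ∈ K_γ` — below the diagonal `|d_i d_j⁻¹| ≤ 1` (★ FILE 1 `v_ratio_le_one_of_gt`),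
above it `v_{ij} = 0`. [cite: HarishChandra1970, Part VII §8 p. 81] -/
theorem conj_mem_level_of_plus_of_mem_Nbar {γ : ValueGroupWithZero K} (hγ : γ ≤ 1) :
    ∀ a ∈ {a : ↥(unitaryGroupOfForm σ J) | ∃ d : Fin 3 → Kˣ, glDiagonal 3 K d = (a : GL (Fin 3) K) ∧ 1 ≤ Valued.v (d 0 : K)},
      ∀ v ∈ (congruenceGL 3 γ).comap (unitaryGroupOfForm σ J).subtype ⊓ ((borelTriple σ J hJ).N).map (MulAut.conj (weylLongU σ hJ)).toMonoidHom,
        a * v * a⁻¹ ∈ (congruenceGL 3 γ).comap (unitaryGroupOfForm σ J).subtype := by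
  rintro a ⟨d, hd, hplus⟩ v hv
  obtain ⟨hvK, hvN⟩ := Subgroup.mem_inf.1 hv
  have hvK' : (v : GL (Fin 3) K) ∈ congruenceGL 3 γ := hvK
  have key : ∀ x : ↥(unitaryGroupOfForm σ J), (x : GL (Fin 3) K) ∈ congruenceGL 3 γ →
      x ∈ ((borelTriple σ J hJ).N).map (MulAut.conj (weylLongU σ hJ)).toMonoidHom →
      ValBound γ ((((a * x * a⁻¹ : ↥(unitaryGroupOfForm σ J)) : GL (Fin 3) K) : Matrix (Fin 3) (Fin 3) K) - 1) := by
    intro x hxK hxN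
    obtain ⟨h1, h0⟩ := apply_of_mem_Nbar σ hJ hxN
    have hmat : (((a * x * a⁻¹ : ↥(unitaryGroupOfForm σ J)) : GL (Fin 3) K) : Matrix (Fin 3) (Fin 3) K) =
        diagonal (fun i => (d i : K)) * ((x : GL (Fin 3) K) : Matrix (Fin 3) (Fin 3) K) * diagonal fun i => ((d i : K))⁻¹ := by
      ext i j; rw [coe_conj_diag_apply σ hd, K2E3CuspFormCancellationU3Torus.diagonal_mul_mul_diagonal_apply]
    rw [hmat]
    refine valBound_diag_conj_sub_one d h1 hxK.2.1 fun i j hij hne => ?_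
    rcases lt_or_gt_of_ne hij with hlt | hgt
    · exact absurd (h0 i j hlt) hne
    · exact v_ratio_le_one_of_gt σ hσv hJ hd hplus hgt
  refine mem_level_of_valBound σ hγ (key v hvK' hvN) ?_
  have e : ((a * v * a⁻¹ : ↥(unitaryGroupOfForm σ J)) : GL (Fin 3) K)⁻¹ = ((a * v⁻¹ * a⁻¹ : ↥(unitaryGroupOfForm σ J)) : GL (Fin 3) K) := by
    rw [← Subgroup.coe_inv]; congr 1; group
  rw [e]
  exact key v⁻¹ ((congruenceGL 3 γ).inv_mem hvK') (Subgroup.inv_mem _ hvN)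

include hσv hJ in
/-- **`hminusV`**: for `a ∈ A⁻` (`|d₀| ≤ 1`) and `u ∈ K_γ ⊓ N`: `a u a⁻¹ ∈ K_γ` (above the diagonal `|d_i d_j⁻¹| ≤ 1`, below it `u_{ij} = 0`).
[cite: HarishChandra1970, Part VII §8 p. 81] -/
theorem conj_mem_level_of_minus_of_mem_N {γ : ValueGroupWithZero K} (hγ : γ ≤ 1) :
    ∀ a ∈ {a : ↥(unitaryGroupOfForm σ J) | ∃ d : Fin 3 → Kˣ, glDiagonal 3 K d = (a : GL (Fin 3) K) ∧ Valued.v (d 0 : K) ≤ 1},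
      ∀ u ∈ (congruenceGL 3 γ).comap (unitaryGroupOfForm σ J).subtype ⊓ (borelTriple σ J hJ).N,
        a * u * a⁻¹ ∈ (congruenceGL 3 γ).comap (unitaryGroupOfForm σ J).subtype := by
  rintro a ⟨d, hd, hminus⟩ u hu
  obtain ⟨huK, huN⟩ := Subgroup.mem_inf.1 hu
  have huK' : (u : GL (Fin 3) K) ∈ congruenceGL 3 γ := huK
  have key : ∀ x : ↥(unitaryGroupOfForm σ J), (x : GL (Fin 3) K) ∈ congruenceGL 3 γ → x ∈ (borelTriple σ J hJ).N →
      ValBound γ ((((a * x * a⁻¹ : ↥(unitaryGroupOfForm σ J)) : GL (Fin 3) K) : Matrix (Fin 3) (Fin 3) K) - 1) := by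
    intro x hxK hxN
    obtain ⟨h1, h0⟩ := apply_of_mem_N σ hJ hxN
    have hmat : (((a * x * a⁻¹ : ↥(unitaryGroupOfForm σ J)) : GL (Fin 3) K) : Matrix (Fin 3) (Fin 3) K) =
        diagonal (fun i => (d i : K)) * ((x : GL (Fin 3) K) : Matrix (Fin 3) (Fin 3) K) * diagonal fun i => ((d i : K))⁻¹ := by
      ext i j; rw [coe_conj_diag_apply σ hd, K2E3CuspFormCancellationU3Torus.diagonal_mul_mul_diagonal_apply]
    rw [hmat]
    refine valBound_diag_conj_sub_one d h1 hxK.2.1 fun i j hij hne => ?_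
    rcases lt_or_gt_of_ne hij with hlt | hgt
    · exact v_ratio_le_one_of_lt σ hσv hJ hd hminus hlt
    · exact absurd (h0 i j hgt) hne
  refine mem_level_of_valBound σ hγ (key u huK' huN) ?_
  have e : ((a * u * a⁻¹ : ↥(unitaryGroupOfForm σ J)) : GL (Fin 3) K)⁻¹ = ((a * u⁻¹ * a⁻¹ : ↥(unitaryGroupOfForm σ J)) : GL (Fin 3) K) := by
    rw [← Subgroup.coe_inv]; congr 1; group
  rw [e]
  exact key u⁻¹ ((congruenceGL 3 γ).inv_mem huK') (Subgroup.inv_mem _ huN)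

include hσv hJ hϖ hmem hinv in
/-- **`hplusC`** (Lemma 55 for `A⁺` on `N`): for `a ∈ A⁺` with `a ∉ Ω_h`, `j + c ≤ h + 1`, and `n ∈ N ∩ Ω_c`: `a⁻¹ n a ∈ K_{|ϖ|^j}` — the root values above the diagonal are
`≤ |d₀⁻¹| ≤ |ϖ^{h+1}|` (★ FILE 1), the entries of `n^{±1}` are `≤ |ϖ|^{−c}`. [cite: HarishChandra1970, Part VII §8 Lemma 55 p. 83] [cite: Casselman1995, Prop. 1.4.3] -/
theorem inv_conj_mem_level_of_plus_of_mem_N :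
    ∀ a ∈ {a : ↥(unitaryGroupOfForm σ J) | ∃ d : Fin 3 → Kˣ, glDiagonal 3 K d = (a : GL (Fin 3) K) ∧ 1 ≤ Valued.v (d 0 : K)},
      ∀ (h c j : ℕ), a ∉ Ω h → j + c ≤ h + 1 → ∀ n ∈ (borelTriple σ J hJ).N, n ∈ Ω c →
        a⁻¹ * n * a ∈ (congruenceGL 3 (valuation K ϖ ^ j)).comap (unitaryGroupOfForm σ J).subtype := by
  rintro a ⟨d, hd, hplus⟩ h c j hah hjc n hn hnc
  have hρ : Valued.v ((d 0 : K))⁻¹ ≤ Valued.v (ϖ ^ (h + 1)) := v_inv_le_pow_succ_of_not_mem σ hσv hJ hϖ Ω hmem hd hplus hah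
  have key : ∀ x : ↥(unitaryGroupOfForm σ J), x ∈ (borelTriple σ J hJ).N → x ∈ Ω c →
      ValBound (valuation K ϖ ^ j) ((((a⁻¹ * x * a : ↥(unitaryGroupOfForm σ J)) : GL (Fin 3) K) : Matrix (Fin 3) (Fin 3) K) - 1) := by
    intro x hxN hxc
    obtain ⟨h1, h0⟩ := apply_of_mem_N σ hJ hxN
    have hmat : (((a⁻¹ * x * a : ↥(unitaryGroupOfForm σ J)) : GL (Fin 3) K) : Matrix (Fin 3) (Fin 3) K) =
        diagonal (fun i => ((d i : K))⁻¹) * ((x : GL (Fin 3) K) : Matrix (Fin 3) (Fin 3) K) * diagonal fun i => (d i : K) := by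
      ext i j; rw [coe_inv_conj_diag_apply σ hd, K2E3CuspFormCancellationU3Torus.diagonal_mul_mul_diagonal_apply]
    rw [hmat]
    refine valBound_diag_inv_conj_sub_one_le_pow hϖ d h1 ((hmem c x).1 hxc).1 (fun i j hij hne => ?_) hjc
    rcases lt_or_gt_of_ne hij with hlt | hgt
    · exact (v_ratio_le_inv_of_lt σ hσv hJ hd hplus hlt).trans hρ
    · exact absurd (h0 i j hgt) hne
  refine mem_level_of_valBound σ (valuation_pow_le_one hϖ j) (key n hn hnc) ?_
  have e : ((a⁻¹ * n * a : ↥(unitaryGroupOfForm σ J)) : GL (Fin 3) K)⁻¹ = ((a⁻¹ * n⁻¹ * a : ↥(unitaryGroupOfForm σ J)) : GL (Fin 3) K) := by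
    rw [← Subgroup.coe_inv]; congr 1; group
  rw [e]
  exact key n⁻¹ ((borelTriple σ J hJ).N.inv_mem hn) (hinv c n hnc)

include hσv hJ hϖ hmem hinv in
/-- **`hminusC`** (Lemma 55 for `A⁻` on `N̄`): for `a ∈ A⁻` with `a ∉ Ω_h`, `j + c ≤ h + 1`, and `v ∈ N̄ ∩ Ω_c`: `a⁻¹ v a ∈ K_{|ϖ|^j}` (root values below the diagonal
`≤ |d₀| ≤ |ϖ^{h+1}|`). [cite: HarishChandra1970, Part VII §8 Lemma 55 p. 83] [cite: Casselman1995, Prop. 1.4.3] -/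
theorem inv_conj_mem_level_of_minus_of_mem_Nbar :
    ∀ a ∈ {a : ↥(unitaryGroupOfForm σ J) | ∃ d : Fin 3 → Kˣ, glDiagonal 3 K d = (a : GL (Fin 3) K) ∧ Valued.v (d 0 : K) ≤ 1},
      ∀ (h c j : ℕ), a ∉ Ω h → j + c ≤ h + 1 → ∀ v ∈ ((borelTriple σ J hJ).N).map (MulAut.conj (weylLongU σ hJ)).toMonoidHom, v ∈ Ω c →
        a⁻¹ * v * a ∈ (congruenceGL 3 (valuation K ϖ ^ j)).comap (unitaryGroupOfForm σ J).subtype := by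
  rintro a ⟨d, hd, hminus⟩ h c j hah hjc v hv hvc
  have hρ : Valued.v (d 0 : K) ≤ Valued.v (ϖ ^ (h + 1)) := v_le_pow_succ_of_not_mem σ hσv hJ hϖ Ω hmem hd hminus hah
  have key : ∀ x : ↥(unitaryGroupOfForm σ J), x ∈ ((borelTriple σ J hJ).N).map (MulAut.conj (weylLongU σ hJ)).toMonoidHom → x ∈ Ω c →
      ValBound (valuation K ϖ ^ j) ((((a⁻¹ * x * a : ↥(unitaryGroupOfForm σ J)) : GL (Fin 3) K) : Matrix (Fin 3) (Fin 3) K) - 1) := by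
    intro x hxN hxc
    obtain ⟨h1, h0⟩ := apply_of_mem_Nbar σ hJ hxN
    have hmat : (((a⁻¹ * x * a : ↥(unitaryGroupOfForm σ J)) : GL (Fin 3) K) : Matrix (Fin 3) (Fin 3) K) =
        diagonal (fun i => ((d i : K))⁻¹) * ((x : GL (Fin 3) K) : Matrix (Fin 3) (Fin 3) K) * diagonal fun i => (d i : K) := by
      ext i j; rw [coe_inv_conj_diag_apply σ hd, K2E3CuspFormCancellationU3Torus.diagonal_mul_mul_diagonal_apply]
    rw [hmat]
    refine valBound_diag_inv_conj_sub_one_le_pow hϖ d h1 ((hmem c x).1 hxc).1 (fun i j hij hne => ?_) hjc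
    rcases lt_or_gt_of_ne hij with hlt | hgt
    · exact absurd (h0 i j hlt) hne
    · exact (v_ratio_le_of_gt σ hσv hJ hd hminus hgt).trans hρ
  refine mem_level_of_valBound σ (valuation_pow_le_one hϖ j) (key v hv hvc) ?_
  have e : ((a⁻¹ * v * a : ↥(unitaryGroupOfForm σ J)) : GL (Fin 3) K)⁻¹ = ((a⁻¹ * v⁻¹ * a : ↥(unitaryGroupOfForm σ J)) : GL (Fin 3) K) := by
    rw [← Subgroup.coe_inv]; congr 1; group
  rw [e]
  exact key v⁻¹ (Subgroup.inv_mem _ hv) (hinv c v hvc)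

/-! ## §5 `K_γ ⊆ Ω_0` and the conjugate level `K₀(y⁻¹) = K₀ ⊓ y⁻¹K₀y` -/

include hmem in
/-- **`K_γ ∩ U ⊆ Ω_0`** (★ (T20-c) §4 `forall_v_pow_zero_mul_le_one_of_mem_comap_congruenceGL` read through `hmem`). [cite: HarishChandra1970, Part VII §2 p. 69] -/
theorem coe_level_subset_heightBall_zero (γ : ValueGroupWithZero K) :
    (((congruenceGL 3 γ).comap (unitaryGroupOfForm σ J).subtype : Subgroup ↥(unitaryGroupOfForm σ J)) : Set ↥(unitaryGroupOfForm σ J)) ⊆ Ω 0 :=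
  fun k hk => (hmem 0 k).2 (K2E3IwahoriFactorisedLevelU3.forall_v_pow_zero_mul_le_one_of_mem_comap_congruenceGL σ ϖ hk)

omit [Valued K ℤᵐ⁰] [ValuativeRel K] [(Valued.v : Valuation K ℤᵐ⁰).Compatible] in
/-- The conjugate level: `k ∈ K₀ ⊓ K₀.map (conj y⁻¹) ↔ k ∈ K₀ ∧ y k y⁻¹ ∈ K₀` (print's `K₀(y⁻¹) = K₀ ∩ K₀^{y⁻¹}`). [cite: HarishChandra1970, Part VII §8 p. 80] -/
theorem mem_inf_map_conj_inv_iff (K₀ : Subgroup ↥(unitaryGroupOfForm σ J)) (y k : ↥(unitaryGroupOfForm σ J)) :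
    k ∈ K₀ ⊓ K₀.map (MulAut.conj y⁻¹).toMonoidHom ↔ k ∈ K₀ ∧ y * k * y⁻¹ ∈ K₀ := by
  rw [Subgroup.mem_inf, Subgroup.mem_map_equiv, MulAut.conj_symm_apply, inv_inv]

end Model

end Summit.HodgeConjecture.HodgeConjecture.Cruxes.H413.K2E3CuspFormCancellationU3Inputs

end
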